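import Summits.Ventures.HodgeRepro2.T5KFiniteOpenStabilizer
import Summits.Ventures.HodgeRepro2.T5FlathAdmissibleAssembly

/-!
# T5KTypeOpenKernel — «ρ_f is trivial on an open subgroup K′_f», and STEP 6 with that input

Cell pub-hodge-repro2, seat p5, Tier 5 (route/T5-N4-p5.md, N4.3 v13 (A3) STEP 6, l. 147: «An
irreducible finite-dimensional representation ρ of K is ρ_∞ ⊗ ρ_f with ρ_f a continuous
finite-dimensional representation of the profinite K_f^{max}, trivial on an open normal subgroup
K′_f»).  Row 12 (`T5KFiniteOpenStabilizer.exists_openSubgroup_forall_eq_one`) proves, for a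
compact totally disconnected group `K₂` and a strongly continuous isometric representation on a
finite-dimensional inner product space, that some open subgroup acts trivially («no small
subgroups» of the circle, trig-free).  This file feeds that to row 83:

* `inrRep`: the `K₂`-part `k ↦ ρ (1, k)` of a finite-dimensional `ρ : Representation ℂ (K₁ × K₂) V`
  on an inner product space, as a `K₂ →* (V →L[ℂ] V)`;
* **`exists_openSubgroup_inr_eq_id`**: if every `ρ (1, k)` preserves the norm and `k ↦ ρ (1, k) v`
  is continuous, some open subgroup `K' ≤ K₂` has `ρ (1, k) = id` for all `k ∈ K'`;
* **`exists_openSubgroup_finite_isotypicComponent`**: STEP 6 with the topological input in place of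
  row 83's `hK'` — for such `ρ`, irreducible, with a simple `S₁ ≤ ρ|_{K₁}`, there is an open subgroup
  `K'` of `K₂` such that `M(ρ)` is finite-dimensional as soon as `(M^{K'})[S₁]` is.

Imports rows 12 / 83.  Axioms: propext, Classical.choice, Quot.sound.
README §8(d): uses an L-value-free non-vanishing device: NO.
-/

namespace Summit.Ventures.HodgeRepro2.T5KTypeOpenKernel

open Summit.Ventures.HodgeRepro2.T5FlathAdmissibleAssembly (fixedSubmodule finite_isotypicComponent_of_fixed)
open Summit.Ventures.HodgeRepro2.T5IsotypicRestrict (compRep)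

variable {K₁ K₂ : Type*} [Monoid K₁] [Group K₂]
variable {V : Type*} [NormedAddCommGroup V] [InnerProductSpace ℂ V] [FiniteDimensional ℂ V]

/-- The `K₂`-part `k ↦ ρ (1, k)` of a finite-dimensional representation of `K₁ × K₂`, as continuous
linear operators. -/
noncomputable def inrRep (ρ : Representation ℂ (K₁ × K₂) V) : K₂ →* (V →L[ℂ] V) where
  toFun k := LinearMap.toContinuousLinearMap (ρ (1, k))
  map_one' := by
    apply ContinuousLinearMap.coe_inj.mp
    rw [LinearMap.coe_toContinuousLinearMap]
    have : ((1 : K₁), (1 : K₂)) = 1 := rfl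
    rw [this, map_one]
    rfl
  map_mul' k l := by
    apply ContinuousLinearMap.coe_inj.mp
    rw [LinearMap.coe_toContinuousLinearMap]
    have : ((1 : K₁), k * l) = (1, k) * (1, l) := by simp
    rw [this, map_mul]
    rfl

/-- `inrRep ρ k v = ρ (1, k) v`. -/
@[simp] theorem inrRep_apply (ρ : Representation ℂ (K₁ × K₂) V) (k : K₂) (v : V) :
    inrRep ρ k v = ρ (1, k) v := by
  simp [inrRep]

variable [TopologicalSpace K₂] [IsTopologicalGroup K₂] [CompactSpace K₂]
  [TotallyDisconnectedSpace K₂]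

/-- **«ρ_f is trivial on an open subgroup K′_f»** (row 12 for the `K₂`-part of `ρ`): if every
`ρ (1, k)` preserves the norm and `k ↦ ρ (1, k) v` is continuous, some open subgroup `K'` of the
compact totally disconnected `K₂` acts trivially. -/
theorem exists_openSubgroup_inr_eq_id (ρ : Representation ℂ (K₁ × K₂) V)
    (hnorm : ∀ (k : K₂) (v : V), ‖ρ (1, k) v‖ = ‖v‖)
    (hcont : ∀ v : V, Continuous fun k : K₂ => ρ (1, k) v) :
    ∃ K' : OpenSubgroup K₂, ∀ k ∈ K', ρ (1, k) = LinearMap.id := by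
  obtain ⟨H, hH⟩ := T5KFiniteOpenStabilizer.exists_openSubgroup_forall_eq_one (inrRep ρ)
    (fun k v => by rw [inrRep_apply]; exact hnorm k v)
    (fun v => by simpa only [inrRep_apply] using hcont v)
  refine ⟨H, fun k hk => ?_⟩
  ext v
  have h := congrArg (fun T : V →L[ℂ] V => T v) (hH k hk)
  simp only [inrRep_apply, one_apply_eq_self] at h
  rw [LinearMap.id_apply]
  exact h

/-- **STEP 6 with the topological input**: for `π` a representation of `K₁ × K₂` on `M`, `ρ` an
irreducible finite-dimensional representation whose `K₂`-part is norm-preserving and strongly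
continuous, and `S₁` a simple `ℂ[K₁]`-submodule of `ρ|_{K₁}`, there is an open subgroup `K'` of `K₂`
such that `M(ρ)` is finite-dimensional whenever `(M^{K'})[S₁]` is. -/
theorem exists_openSubgroup_finite_isotypicComponent {M : Type*} [AddCommGroup M] [Module ℂ M]
    (π : Representation ℂ (K₁ × K₂) M) (ρ : Representation ℂ (K₁ × K₂) V) [ρ.IsIrreducible]
    (S₁ : Submodule (MonoidAlgebra ℂ K₁) (compRep (MonoidHom.inl K₁ K₂) ρ).asModule)
    [IsSimpleModule (MonoidAlgebra ℂ K₁) S₁]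
    (hnorm : ∀ (k : K₂) (v : V), ‖ρ (1, k) v‖ = ‖v‖)
    (hcont : ∀ v : V, Continuous fun k : K₂ => ρ (1, k) v) :
    ∃ K' : OpenSubgroup K₂,
      Module.Finite ℂ (isotypicComponent (MonoidAlgebra ℂ K₁) (fixedSubmodule π (K' : Set K₂)) S₁) →
        Module.Finite ℂ (isotypicComponent (MonoidAlgebra ℂ (K₁ × K₂)) π.asModule ρ.asModule) := by
  obtain ⟨K', hK'⟩ := exists_openSubgroup_inr_eq_id ρ hnorm hcont
  refine ⟨K', fun hfin => ?_⟩
  exact finite_isotypicComponent_of_fixed π ρ S₁ (K' : Set K₂) (fun k hk => hK' k hk)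

end Summit.Ventures.HodgeRepro2.T5KTypeOpenKernel
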